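import Summits.QuantumFields.YangMills.Theorems.UnitScaleTiltProp7ConeRegaugeAlgebra
import Literature.MathematicalPhysics.QuantumFieldTheory.Balaban1983to89.B10Eq27TorusAxialLog
import Literature.MathematicalPhysics.QuantumFieldTheory.Balaban1983to89.B3ConstantField433
import HarnessLib

/-!
# Route `UnitScaleTilt`, crux K1 «MinimiserStabilityRegPr» (stmt-QuantumFields-19200), route-R E′ path (α′), (E1-b) covariant, (N-cov) near field — «CONE ROWS», FILE B:
# THE REGAUGED ROWS ON THE TORUS — for ANY link field `h_μ(x)` (bi-contractive) with the two BALL ROWS `‖h_μ(x) − 1‖ ≤ τ₁`, `‖h_μ(x + e_ν) − h_μ(x)‖ ≤ τ₂` (all `μ, ν`,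
# `tdist(x, y₀) ≤ R`), the ordered-power regauge `g(x) := P(rel y₀ x)⁻¹` at the pole `y₀` gives links `h′_μ(x) = P(w)·h_μ(x)·P(w + e_μ)⁻¹` (`w = rel y₀ x`) with
# CONE SIZE `‖h′_μ(x) − 1‖ ≤ (τ₂ + 2τ₁²)·tdist(x, y₀)` (zero at the pole) and DIFFERENCE `‖h′_μ(x + e_ν) − h′_μ(x)‖ ≤ τ₂ + 4τ₁² + 2τ₁τ₂·(tdist(x, y₀) + 1)`

Cell `ym3-torus`, extra width seat `ym-routeR-w4` (g10); ★routeR-w3 g6 NAMER WORD (11) 2026-08-28T22:14Z on ym-routeR-w6 g6's spec (22:12:41Z): with `τ₁ ≍ e∕ℓ`, `τ₂ = a ≍ e∕ℓ²`,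
`R ≍ ℓ` the regauged size row grows LINEARLY from the pole with slope `a(1 + 2e)` and the difference row stays `a(1 + O(e))` — the letter the framed near-field transplant
(LOCATE-PCOV2 §5) needs to make every junk density `≤ C·a·(1 ∨ r)⁻²` (no `log ℓ`).  THEOREMS ONLY (0 `def`, 0 `sorry`); `--supports stmt-QuantumFields-19200`, count-neutral.
YM₃ on T³ is a ladder rung (R3), not the Clay problem; nothing here claims a stub, the crux, d = 4 or the mass gap.

INPUTS BY NAME.  FILE A ✓ `Prop7ConeRegaugeAlgebra` (`prod_ofFn_zpow_add_single`, `tailProd_add_single_of_lt∕_of_le`, `norm_conjTail_sub_le`, `norm_conjTail_sub_one_le`,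
`norm_conj_sub_conj_le_comm`, bi-contractivity); the torus lift ✓ `B10Eq27TorusAxialLog.rel` (`valMinAbs` coordinates; `rel_self`, no-wrap `rel_shift_of_le`); the telescope
✓ `B3ConstantField433.norm_sub_le_local` (staircase inside the `ℓ¹`-ball) and ✓ `B3Taylor310LocalRemainder.tdist_eq_sum_natAbs` (`Σ_i |rel_i| = tdist`).

WHAT IS PROVED (ns `…Theorems.Prop7ConeRegaugeRows`; `P(w) := (List.ofFn fun i => h i y₀ ^ w i).prod`, written out).
* §1 (normed ring; abstract units `P P′ H H′ k k̃ k̂`) `norm_mul_mul_le_of_le_one` (+ ✓`B9Thm310CommutatorDataOfPlaquettes.norm_inv_sub_one_le_of_bicontr`); ★★ `norm_regauged_sub_one_le` — SIZE ALGEBRA: `P′ = P·k̃`,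
  `‖H − k‖ ≤ δ`, `‖k̃ − k‖ ≤ ε` ⇒ `‖P·H·P′⁻¹ − 1‖ ≤ δ + ε`; ★★ `norm_regauged_sub_regauged_le` — DIFFERENCE ALGEBRA:
  `‖(Pk̃)·H′·(P′k̂)⁻¹ − P·H·P′⁻¹‖ ≤ ‖H′ − H‖ + ‖k̃ − k̂‖ + 2‖k̂ − 1‖‖k − 1‖ + (‖k̃ − 1‖ + ‖k̂ − 1‖)·‖H′ − k‖`.
* §2 (torus `Site P j`, any `d`, any link field) `norm_link_sub_tilt_le` (`‖h_μ(x) − h_μ(y₀)‖ ≤ τ₂·tdist(x,y₀)` on the ball); `natAbs_rel_le_tdist`, `sum_natAbs_rel_eq_tdist`,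
  `rel_shift_eq_add_single` (no wrap-around under `2R + 4 ≤ N`); ★★★ `cone_size_row`; ★★★ `cone_diff_row` (the two displayed rows above).
HONEST SCOPE.  Bookkeeping over FILE A and the tree's torus letters; the frame rows are HYPOTHESES here (member: ✓ `Prop7MemberBallFrames.exists_ballFrame_of_regPr`, FILE C).

References: T. Bałaban, CMP 99 (1985) 389–434 [Balaban1985BackgroundPropagators] ((3.28) p.395, (3.35) p.396); CMP 88 (1983) 411–445 [Balaban1983Higgs3] (p.433, the lattice
mean-value telescope); CMP 102 (1985) 255–275 [Balaban1985UV3] ((27) p.263).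
-/

set_option autoImplicit false

noncomputable section

namespace Summit.QuantumFields.YangMills.Theorems.Prop7ConeRegaugeRows

open Literature.MathematicalPhysics.QuantumFieldTheory.Balaban1983to89
open B9Thm310CommutatorDataOfPlaquettes (bicontr_mul bicontr_inv norm_inv_sub_one_le_of_bicontr)
open B9Eq335PlaquetteAtLettersY (norm_conj_sub_one_le)
open B9Eq335Plaquette (norm_comm_le)
open B10Eq27TorusAxialLog (rel rel_apply rel_self rel_shift_of_le)
open B3ConstantField433 (norm_sub_le_local)
open B3Taylor310LocalRemainder (tdist_eq_sum_natAbs tdist_comm tdist_self)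
open Summit.QuantumFields.YangMills.Theorems.Prop7ConeRegaugeAlgebra (prod_ofFn_zpow_add_single tailProd_add_single_of_lt tailProd_add_single_of_le
  norm_conjTail_sub_le norm_conjTail_sub_one_le bicontr_tailProd bicontr_prod_ofFn_zpow norm_conj_sub_conj_le_comm)

/-! ## §1 The two row algebras (normed ring; abstract units) -/

section RowAlgebra

variable {𝔸 : Type} [NormedRing 𝔸]

/-- `‖A·X·B‖ ≤ ‖X‖` for contractions `A, B`. [folklore] -/
theorem norm_mul_mul_le_of_le_one (A X B : 𝔸) (hA : ‖A‖ ≤ 1) (hB : ‖B‖ ≤ 1) : ‖A * X * B‖ ≤ ‖X‖ :=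
  calc ‖A * X * B‖ ≤ ‖A * X‖ * ‖B‖ := norm_mul_le _ _
    _ ≤ ‖A * X‖ := mul_le_of_le_one_right (norm_nonneg _) hB
    _ ≤ ‖A‖ * ‖X‖ := norm_mul_le _ _
    _ ≤ ‖X‖ := mul_le_of_le_one_left (norm_nonneg _) hA

/-- ★★ **SIZE ROW ALGEBRA**: `P′ = P·k̃`, `‖H − k‖ ≤ δ`, `‖k̃ − k‖ ≤ ε`, everything bi-contractive ⇒ `‖P·H·P′⁻¹ − 1‖ ≤ δ + ε`
(`P·H·P′⁻¹ − 1 = P(H − k)P′⁻¹ + P(k·k̃⁻¹ − 1)P⁻¹`, `k·k̃⁻¹ − 1 = (k − k̃)k̃⁻¹`). [cite: Balaban1985BackgroundPropagators, (3.28) p.395, (3.35) p.396, bookkeeping] -/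
theorem norm_regauged_sub_one_le {P P' H k kt : 𝔸ˣ} (hPP : P' = P * kt)
    (hP : ‖(P : 𝔸)‖ ≤ 1 ∧ ‖((P⁻¹ : 𝔸ˣ) : 𝔸)‖ ≤ 1) (hP' : ‖(P' : 𝔸)‖ ≤ 1 ∧ ‖((P'⁻¹ : 𝔸ˣ) : 𝔸)‖ ≤ 1)
    (hkt : ‖(kt : 𝔸)‖ ≤ 1 ∧ ‖((kt⁻¹ : 𝔸ˣ) : 𝔸)‖ ≤ 1)
    {δ ε : ℝ} (hH : ‖(H : 𝔸) - k‖ ≤ δ) (hk : ‖(kt : 𝔸) - k‖ ≤ ε) :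
    ‖((P * H * P'⁻¹ : 𝔸ˣ) : 𝔸) - 1‖ ≤ δ + ε := by
  have e : ((P * H * P'⁻¹ : 𝔸ˣ) : 𝔸) - 1
      = (P : 𝔸) * ((H : 𝔸) - k) * ((P'⁻¹ : 𝔸ˣ) : 𝔸) + ((((P⁻¹)⁻¹ * (k * kt⁻¹) * P⁻¹ : 𝔸ˣ) : 𝔸) - 1) := by
    rw [inv_inv, hPP, mul_inv_rev]
    push_cast
    noncomm_ring
  rw [e]
  have h1 : ‖(P : 𝔸) * ((H : 𝔸) - k) * ((P'⁻¹ : 𝔸ˣ) : 𝔸)‖ ≤ δ :=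
    (norm_mul_mul_le_of_le_one _ _ _ hP.1 hP'.2).trans hH
  have h2 : ‖((((P⁻¹)⁻¹ * (k * kt⁻¹) * P⁻¹ : 𝔸ˣ) : 𝔸)) - 1‖ ≤ ε := by
    refine (norm_conj_sub_one_le (bicontr_inv hP) (k * kt⁻¹)).trans ?_
    have e2 : ((k * kt⁻¹ : 𝔸ˣ) : 𝔸) - 1 = ((k : 𝔸) - kt) * ((kt⁻¹ : 𝔸ˣ) : 𝔸) := by
      rw [sub_mul, Units.val_mul, Units.mul_inv]
    rw [e2]
    calc _ ≤ ‖(k : 𝔸) - kt‖ * ‖((kt⁻¹ : 𝔸ˣ) : 𝔸)‖ := norm_mul_le _ _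
      _ ≤ ‖(k : 𝔸) - kt‖ := mul_le_of_le_one_right (norm_nonneg _) hkt.2
      _ ≤ ε := by rw [norm_sub_rev]; exact hk
  exact (norm_add_le _ _).trans (add_le_add h1 h2)

/-- ★★ **DIFFERENCE ROW ALGEBRA**: with `P P′ H H′ k k̃ k̂` bi-contractive units,
`‖(P·k̃)·H′·(P′·k̂)⁻¹ − P·H·P′⁻¹‖ ≤ ‖H′ − H‖ + ‖k̃ − k̂‖ + 2‖k̂ − 1‖·‖k − 1‖ + (‖k̃ − 1‖ + ‖k̂ − 1‖)·‖H′ − k‖`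
(`= ‖P(k̃H′k̂⁻¹ − H)P′⁻¹‖`; `k̃H′k̂⁻¹ − H = (k̃k − kk̂)k̂⁻¹ + [(k̃ − 1)(H′ − k)k̂⁻¹ + (H′ − k)(k̂⁻¹ − 1)] + (H′ − H)`).
[cite: Balaban1985BackgroundPropagators, (3.28) p.395, (3.35) p.396, bookkeeping] -/
theorem norm_regauged_sub_regauged_le {P P' H H' k kt kh : 𝔸ˣ}
    (hP : ‖(P : 𝔸)‖ ≤ 1 ∧ ‖((P⁻¹ : 𝔸ˣ) : 𝔸)‖ ≤ 1) (hP' : ‖(P' : 𝔸)‖ ≤ 1 ∧ ‖((P'⁻¹ : 𝔸ˣ) : 𝔸)‖ ≤ 1)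
    (hk0 : ‖(k : 𝔸)‖ ≤ 1) (hkh : ‖(kh : 𝔸)‖ ≤ 1 ∧ ‖((kh⁻¹ : 𝔸ˣ) : 𝔸)‖ ≤ 1) :
    ‖((P * kt * H' * (P' * kh)⁻¹ : 𝔸ˣ) : 𝔸) - ((P * H * P'⁻¹ : 𝔸ˣ) : 𝔸)‖
      ≤ ‖(H' : 𝔸) - H‖ + ‖(kt : 𝔸) - kh‖ + 2 * ‖(kh : 𝔸) - 1‖ * ‖(k : 𝔸) - 1‖
        + (‖(kt : 𝔸) - 1‖ + ‖(kh : 𝔸) - 1‖) * ‖(H' : 𝔸) - k‖ := by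
  -- reduce to the inner bracket
  have e : ((P * kt * H' * (P' * kh)⁻¹ : 𝔸ˣ) : 𝔸) - ((P * H * P'⁻¹ : 𝔸ˣ) : 𝔸)
      = (P : 𝔸) * (((kt : 𝔸) * H' * ((kh⁻¹ : 𝔸ˣ) : 𝔸)) - H) * ((P'⁻¹ : 𝔸ˣ) : 𝔸) := by
    rw [mul_inv_rev]; push_cast; noncomm_ring
  rw [e]
  refine (norm_mul_mul_le_of_le_one _ _ _ hP.1 hP'.2).trans ?_
  -- the three-term splitting of the inner bracket (uses `kh·kh⁻¹ = 1`)
  have hkk : (kh : 𝔸) * ((kh⁻¹ : 𝔸ˣ) : 𝔸) = 1 := Units.mul_inv kh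
  have e2 : (kt : 𝔸) * H' * ((kh⁻¹ : 𝔸ˣ) : 𝔸) - H
      = (((kt : 𝔸) - kh) * k + ((kh : 𝔸) * k - k * kh)) * ((kh⁻¹ : 𝔸ˣ) : 𝔸)
        + (((kt : 𝔸) - 1) * ((H' : 𝔸) - k) * ((kh⁻¹ : 𝔸ˣ) : 𝔸) + ((H' : 𝔸) - k) * (((kh⁻¹ : 𝔸ˣ) : 𝔸) - 1))
        + ((H' : 𝔸) - H) := by
    have h3 : (((kt : 𝔸) - kh) * k + ((kh : 𝔸) * k - k * kh)) * ((kh⁻¹ : 𝔸ˣ) : 𝔸)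
        + (((kt : 𝔸) - 1) * ((H' : 𝔸) - k) * ((kh⁻¹ : 𝔸ˣ) : 𝔸) + ((H' : 𝔸) - k) * (((kh⁻¹ : 𝔸ˣ) : 𝔸) - 1))
        + ((H' : 𝔸) - H)
        = (kt : 𝔸) * H' * ((kh⁻¹ : 𝔸ˣ) : 𝔸) - H + ((k : 𝔸) - k * ((kh : 𝔸) * ((kh⁻¹ : 𝔸ˣ) : 𝔸))) := by
      noncomm_ring
    rw [h3, hkk, mul_one, sub_self, add_zero]
  rw [e2]
  have t1 : ‖(((kt : 𝔸) - kh) * k + ((kh : 𝔸) * k - k * kh)) * ((kh⁻¹ : 𝔸ˣ) : 𝔸)‖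
      ≤ ‖(kt : 𝔸) - kh‖ + 2 * ‖(kh : 𝔸) - 1‖ * ‖(k : 𝔸) - 1‖ := by
    calc _ ≤ ‖((kt : 𝔸) - kh) * k + ((kh : 𝔸) * k - k * kh)‖ * ‖((kh⁻¹ : 𝔸ˣ) : 𝔸)‖ := norm_mul_le _ _
      _ ≤ ‖((kt : 𝔸) - kh) * k + ((kh : 𝔸) * k - k * kh)‖ := mul_le_of_le_one_right (norm_nonneg _) hkh.2
      _ ≤ ‖((kt : 𝔸) - kh) * k‖ + ‖(kh : 𝔸) * k - k * kh‖ := norm_add_le _ _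
      _ ≤ ‖(kt : 𝔸) - kh‖ + 2 * ‖(kh : 𝔸) - 1‖ * ‖(k : 𝔸) - 1‖ :=
          add_le_add ((norm_mul_le _ _).trans (mul_le_of_le_one_right (norm_nonneg _) hk0)) (norm_comm_le _ _)
  have t2 : ‖((kt : 𝔸) - 1) * ((H' : 𝔸) - k) * ((kh⁻¹ : 𝔸ˣ) : 𝔸) + ((H' : 𝔸) - k) * (((kh⁻¹ : 𝔸ˣ) : 𝔸) - 1)‖
      ≤ (‖(kt : 𝔸) - 1‖ + ‖(kh : 𝔸) - 1‖) * ‖(H' : 𝔸) - k‖ := by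
    calc _ ≤ ‖((kt : 𝔸) - 1) * ((H' : 𝔸) - k) * ((kh⁻¹ : 𝔸ˣ) : 𝔸)‖ + ‖((H' : 𝔸) - k) * (((kh⁻¹ : 𝔸ˣ) : 𝔸) - 1)‖ :=
          norm_add_le _ _
      _ ≤ ‖(kt : 𝔸) - 1‖ * ‖(H' : 𝔸) - k‖ + ‖(H' : 𝔸) - k‖ * ‖(kh : 𝔸) - 1‖ := by
          refine add_le_add ?_ ?_
          · exact ((norm_mul_le _ _).trans (mul_le_of_le_one_right (norm_nonneg _) hkh.2)).trans (norm_mul_le _ _)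
          · exact (norm_mul_le _ _).trans (mul_le_mul_of_nonneg_left (norm_inv_sub_one_le_of_bicontr hkh) (norm_nonneg _))
      _ = (‖(kt : 𝔸) - 1‖ + ‖(kh : 𝔸) - 1‖) * ‖(H' : 𝔸) - k‖ := by ring
  calc _ ≤ ‖(((kt : 𝔸) - kh) * k + ((kh : 𝔸) * k - k * kh)) * ((kh⁻¹ : 𝔸ˣ) : 𝔸)
          + (((kt : 𝔸) - 1) * ((H' : 𝔸) - k) * ((kh⁻¹ : 𝔸ˣ) : 𝔸) + ((H' : 𝔸) - k) * (((kh⁻¹ : 𝔸ˣ) : 𝔸) - 1))‖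
          + ‖(H' : 𝔸) - H‖ := norm_add_le _ _
    _ ≤ (‖(kt : 𝔸) - kh‖ + 2 * ‖(kh : 𝔸) - 1‖ * ‖(k : 𝔸) - 1‖) + (‖(kt : 𝔸) - 1‖ + ‖(kh : 𝔸) - 1‖) * ‖(H' : 𝔸) - k‖
          + ‖(H' : 𝔸) - H‖ := by
        have := (norm_add_le _ _).trans (add_le_add t1 t2)
        linarith
    _ = _ := by ring


end RowAlgebra

/-! ## §2 The regauged rows on the torus -/

section Torus

variable {𝔸 : Type} [NormedRing 𝔸] [NormOneClass 𝔸] [NormedSpace ℝ 𝔸] {P : Params} {j : ℕ}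

omit [NormOneClass 𝔸] in
/-- **THE TELESCOPE**: `‖h_μ(x) − h_μ(y₀)‖ ≤ τ₂·tdist(x, y₀)` for `x` in the `R`-ball, from the all-direction difference row on the ball — ✓ `B3ConstantField433.norm_sub_le_local`
(the staircase `Γ_{y₀,x}` stays inside the `ℓ¹`-ball of radius `tdist(x,y₀)`). [cite: Balaban1983Higgs3, p.433] -/
theorem norm_link_sub_tilt_le (h : Fin P.d → Site P j → 𝔸ˣ) (y₀ : Site P j) {R : ℕ} {τ₂ : ℝ}
    (h2 : ∀ (μ ν : Fin P.d) (x : Site P j), Site.tdist x y₀ ≤ R → ‖(h μ (x.shift ν) : 𝔸) - h μ x‖ ≤ τ₂)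
    (μ : Fin P.d) {x : Site P j} (hx : Site.tdist x y₀ ≤ R) :
    ‖(h μ x : 𝔸) - h μ y₀‖ ≤ τ₂ * (Site.tdist x y₀ : ℝ) := by
  have h := norm_sub_le_local (η := 1) one_pos (fun z => (h μ z : 𝔸)) y₀ x (Pb := τ₂) fun z ν hz => by
    simp only [LatticeFieldCalculus.pdiff, inv_one, one_smul]
    exact h2 μ ν z (hz.trans (by rw [tdist_comm]; exact hx))
  rw [one_mul, tdist_comm] at h
  simpa [mul_comm] using h

/-- one relative coordinate is at most the `ℓ¹` distance: `|rel_μ| ≤ tdist`. [folklore] -/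
theorem natAbs_rel_le_tdist (y₀ x : Site P j) (μ : Fin P.d) : (rel y₀ x μ).natAbs ≤ Site.tdist x y₀ := by
  rw [tdist_eq_sum_natAbs, rel_apply]
  exact Finset.single_le_sum (f := fun ν => ((x ν - y₀ ν).valMinAbs).natAbs) (fun _ _ => Nat.zero_le _) (Finset.mem_univ μ)

/-- `Σ_i |rel_i| = tdist`. [folklore] -/
theorem sum_natAbs_rel_eq_tdist (y₀ x : Site P j) : ∑ i, ((rel y₀ x i).natAbs : ℝ) = (Site.tdist x y₀ : ℝ) := by
  rw [tdist_eq_sum_natAbs]; push_cast; simp [rel_apply]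

/-- **NO WRAP-AROUND ON THE BALL**: if `rel_μ ≤ R + 1` and `2R + 4 ≤ N` then `rel y₀ (x + e_μ) = rel y₀ x + e_μ` (✓ `rel_shift_of_le`). [folklore] -/
theorem rel_shift_eq_add_single (y₀ x : Site P j) (μ : Fin P.d) {R : ℕ} (hN : 2 * R + 4 ≤ P.sitesPerDir j) (hx : rel y₀ x μ ≤ (R : ℤ) + 1) :
    rel y₀ (x.shift μ) = (rel y₀ x + Pi.single μ 1 : Fin P.d → ℤ) := by
  have hN' : 2 * (R : ℤ) + 4 ≤ (P.sitesPerDir j : ℤ) := by exact_mod_cast hN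
  have h := rel_shift_of_le y₀ x μ (by linarith)
  rw [h]; rfl

variable (h : Fin P.d → Site P j → 𝔸ˣ) (y₀ : Site P j) {R : ℕ} {τ₁ τ₂ : ℝ}

/-- ★★★ **CONE SIZE ROW**: for a bi-contractive link field with `‖h_μ(x) − 1‖ ≤ τ₁` and `‖h_μ(x+e_ν) − h_μ(x)‖ ≤ τ₂` (all `μ, ν`) on the ball `tdist(x,y₀) ≤ R` (`2R + 4 ≤ N`), the
regauged link `h′_μ(x) = P(w)·h_μ(x)·P(w + e_μ)⁻¹`, `w = rel y₀ x`, `P(w) = ∏_i h_i(y₀)^{w_i}` (ordered), satisfies `‖h′_μ(x) − 1‖ ≤ (τ₂ + 2τ₁²)·tdist(x, y₀)` — ZERO at the pole.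
[cite: Balaban1985BackgroundPropagators, (3.28) p.395, (3.35) p.396; Balaban1985UV3, (27) p.263] -/
theorem cone_size_row (hb : ∀ μ x, ‖(h μ x : 𝔸)‖ ≤ 1 ∧ ‖(((h μ x)⁻¹ : 𝔸ˣ) : 𝔸)‖ ≤ 1)
    (h1 : ∀ (μ : Fin P.d) (x : Site P j), Site.tdist x y₀ ≤ R → ‖(h μ x : 𝔸) - 1‖ ≤ τ₁)
    (h2 : ∀ (μ ν : Fin P.d) (x : Site P j), Site.tdist x y₀ ≤ R → ‖(h μ (x.shift ν) : 𝔸) - h μ x‖ ≤ τ₂)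
    (hN : 2 * R + 4 ≤ P.sitesPerDir j) (μ : Fin P.d) {x : Site P j} (hx : Site.tdist x y₀ ≤ R) :
    ‖(((List.ofFn fun i => h i y₀ ^ rel y₀ x i).prod * h μ x * ((List.ofFn fun i => h i y₀ ^ rel y₀ (x.shift μ) i).prod)⁻¹ : 𝔸ˣ) : 𝔸) - 1‖
      ≤ (τ₂ + 2 * τ₁ ^ 2) * (Site.tdist x y₀ : ℝ) := by
  have hk : ∀ i, ‖(h i y₀ : 𝔸)‖ ≤ 1 ∧ ‖(((h i y₀)⁻¹ : 𝔸ˣ) : 𝔸)‖ ≤ 1 := fun i => hb i y₀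
  have hk1 : ∀ i, ‖(h i y₀ : 𝔸) - 1‖ ≤ τ₁ := fun i => h1 i y₀ (by rw [tdist_self]; exact Nat.zero_le _)
  have hrel : rel y₀ (x.shift μ) = (rel y₀ x + Pi.single μ 1 : Fin P.d → ℤ) :=
    rel_shift_eq_add_single y₀ x μ hN (by have := natAbs_rel_le_tdist y₀ x μ; omega)
  rw [hrel, prod_ofFn_zpow_add_single P.d (fun i => h i y₀) (rel y₀ x) μ]
  have hB := bicontr_tailProd (fun i => h i y₀) hk (rel y₀ x) μ
  calc _ ≤ τ₂ * (Site.tdist x y₀ : ℝ) + 2 * τ₁ ^ 2 * ∑ i, ((rel y₀ x i).natAbs : ℝ) :=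
        norm_regauged_sub_one_le rfl (bicontr_prod_ofFn_zpow _ hk _)
          (by rw [← prod_ofFn_zpow_add_single]; exact bicontr_prod_ofFn_zpow _ hk _)
          (bicontr_mul (bicontr_mul (bicontr_inv hB) (hk μ)) hB)
          (norm_link_sub_tilt_le h y₀ h2 μ hx) (norm_conjTail_sub_le (fun i => h i y₀) hk hk1 (rel y₀ x) μ)
    _ = (τ₂ + 2 * τ₁ ^ 2) * (Site.tdist x y₀ : ℝ) := by rw [sum_natAbs_rel_eq_tdist]; ring

/-- ★★★ **CONE DIFFERENCE ROW**: under the same hypotheses, for all `μ, ν` and `x` in the ball,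
`‖h′_μ(x + e_ν) − h′_μ(x)‖ ≤ τ₂ + 4τ₁² + 2τ₁τ₂·(tdist(x, y₀) + 1)` — the difference row survives the regauge up to `O(τ₁²) + O(τ₁τ₂R)` (with `τ₁R ≍ e`: `τ₂(1 + O(e))`).
[cite: Balaban1985BackgroundPropagators, (3.28) p.395, (3.35) p.396; Balaban1985UV3, (27) p.263] -/
theorem cone_diff_row (hb : ∀ μ x, ‖(h μ x : 𝔸)‖ ≤ 1 ∧ ‖(((h μ x)⁻¹ : 𝔸ˣ) : 𝔸)‖ ≤ 1)
    (h1 : ∀ (μ : Fin P.d) (x : Site P j), Site.tdist x y₀ ≤ R → ‖(h μ x : 𝔸) - 1‖ ≤ τ₁)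
    (h2 : ∀ (μ ν : Fin P.d) (x : Site P j), Site.tdist x y₀ ≤ R → ‖(h μ (x.shift ν) : 𝔸) - h μ x‖ ≤ τ₂)
    (hN : 2 * R + 4 ≤ P.sitesPerDir j) (μ ν : Fin P.d) {x : Site P j} (hx : Site.tdist x y₀ ≤ R) :
    ‖(((List.ofFn fun i => h i y₀ ^ rel y₀ (x.shift ν) i).prod * h μ (x.shift ν) *
          ((List.ofFn fun i => h i y₀ ^ rel y₀ ((x.shift ν).shift μ) i).prod)⁻¹ : 𝔸ˣ) : 𝔸)
        - (((List.ofFn fun i => h i y₀ ^ rel y₀ x i).prod * h μ x * ((List.ofFn fun i => h i y₀ ^ rel y₀ (x.shift μ) i).prod)⁻¹ : 𝔸ˣ) : 𝔸)‖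
      ≤ τ₂ + 4 * τ₁ ^ 2 + 2 * τ₁ * τ₂ * ((Site.tdist x y₀ : ℝ) + 1) := by
  have hk : ∀ i, ‖(h i y₀ : 𝔸)‖ ≤ 1 ∧ ‖(((h i y₀)⁻¹ : 𝔸ˣ) : 𝔸)‖ ≤ 1 := fun i => hb i y₀
  have hk1 : ∀ i, ‖(h i y₀ : 𝔸) - 1‖ ≤ τ₁ := fun i => h1 i y₀ (by rw [tdist_self]; exact Nat.zero_le _)
  have hτ₁ : 0 ≤ τ₁ := (norm_nonneg _).trans (hk1 μ)
  have hτ₂ : 0 ≤ τ₂ := (norm_nonneg _).trans (h2 μ ν y₀ (by rw [tdist_self]; exact Nat.zero_le _))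
  set w : Fin P.d → ℤ := rel y₀ x with hw
  -- the three lifts (no wrap-around)
  have hν : rel y₀ (x.shift ν) = (w + Pi.single ν 1 : Fin P.d → ℤ) :=
    rel_shift_eq_add_single y₀ x ν hN (by have := natAbs_rel_le_tdist y₀ x ν; omega)
  have hμ : rel y₀ (x.shift μ) = (w + Pi.single μ 1 : Fin P.d → ℤ) :=
    rel_shift_eq_add_single y₀ x μ hN (by have := natAbs_rel_le_tdist y₀ x μ; omega)
  have hνμ : rel y₀ ((x.shift ν).shift μ) = ((w + Pi.single μ 1 : Fin P.d → ℤ) + Pi.single ν 1 : Fin P.d → ℤ) := by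
    rw [rel_shift_eq_add_single y₀ (x.shift ν) μ hN, hν, add_right_comm]
    rw [hν, Pi.add_apply]
    have h1' : (w μ).natAbs ≤ Site.tdist x y₀ := natAbs_rel_le_tdist y₀ x μ
    have h2' : (Pi.single ν (1 : ℤ) : Fin P.d → ℤ) μ ≤ 1 := by
      rw [Pi.single_apply]; split_ifs <;> norm_num
    omega
  rw [hν, hμ, hνμ, prod_ofFn_zpow_add_single P.d (fun i => h i y₀) w ν,
    prod_ofFn_zpow_add_single P.d (fun i => h i y₀) (w + Pi.single μ 1 : Fin P.d → ℤ) ν]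
  -- abbreviations for the tails
  have hBν := bicontr_tailProd (fun i => h i y₀) hk w ν
  have hBν' := bicontr_tailProd (fun i => h i y₀) hk (w + Pi.single μ 1 : Fin P.d → ℤ) ν
  have hkt1 := (norm_conjTail_sub_one_le (fun i => h i y₀) hk w ν).trans (hk1 ν)
  have hkh1 := (norm_conjTail_sub_one_le (fun i => h i y₀) hk (w + Pi.single μ 1 : Fin P.d → ℤ) ν).trans (hk1 ν)
  have hkh := bicontr_mul (bicontr_mul (bicontr_inv hBν') (hk ν)) hBν'
  -- the `k̃ ∕ k̂` swap: `‖k̃ − k̂‖ ≤ 2τ₁²`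
  have hswap : ‖((((List.ofFn fun i => if ν < i then h i y₀ ^ w i else 1).prod)⁻¹ * h ν y₀ *
        (List.ofFn fun i => if ν < i then h i y₀ ^ w i else 1).prod : 𝔸ˣ) : 𝔸)
      - ((((List.ofFn fun i => if ν < i then h i y₀ ^ (w + Pi.single μ 1 : Fin P.d → ℤ) i else 1).prod)⁻¹ * h ν y₀ *
        (List.ofFn fun i => if ν < i then h i y₀ ^ (w + Pi.single μ 1 : Fin P.d → ℤ) i else 1).prod : 𝔸ˣ) : 𝔸)‖ ≤ 2 * τ₁ ^ 2 := by
    rcases lt_or_ge ν μ with hlt | hle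
    · -- `ν < μ`: the tail picks up `m := B_μ⁻¹ k_μ B_μ`, and `k̂ = m⁻¹ k̃ m`
      have hBμ := bicontr_tailProd (fun i => h i y₀) hk w μ
      have hm1 := (norm_conjTail_sub_one_le (fun i => h i y₀) hk w μ).trans (hk1 μ)
      have hm := bicontr_mul (bicontr_mul (bicontr_inv hBμ) (hk μ)) hBμ
      rw [tailProd_add_single_of_lt P.d (fun i => h i y₀) w hlt]
      set Bν := (List.ofFn fun i => if ν < i then h i y₀ ^ w i else 1).prod
      set m := ((List.ofFn fun i => if μ < i then h i y₀ ^ w i else 1).prod)⁻¹ * h μ y₀ *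
        (List.ofFn fun i => if μ < i then h i y₀ ^ w i else 1).prod
      have e : ((Bν * m)⁻¹ * h ν y₀ * (Bν * m) : 𝔸ˣ) = m⁻¹ * (Bν⁻¹ * h ν y₀ * Bν) * m := by group
      rw [e, norm_sub_rev]
      calc _ ≤ 2 * ‖((Bν⁻¹ * h ν y₀ * Bν : 𝔸ˣ) : 𝔸) - 1‖ * ‖(m : 𝔸) - 1‖ := by
            have := norm_conj_sub_conj_le_comm ((Bν⁻¹ * h ν y₀ * Bν : 𝔸ˣ) : 𝔸) hm
            simpa only [Units.val_mul] using this
        _ ≤ 2 * τ₁ * τ₁ := by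
            refine mul_le_mul (mul_le_mul_of_nonneg_left hkt1 (by norm_num)) hm1 (norm_nonneg _) (mul_nonneg (by norm_num) hτ₁)
        _ = 2 * τ₁ ^ 2 := by ring
    · -- `μ ≤ ν`: the tail beyond `ν` does not see the `μ`-step
      rw [tailProd_add_single_of_le P.d (fun i => h i y₀) w hle, sub_self, norm_zero]
      positivity
  -- the data rows
  have hHH : ‖(h μ (x.shift ν) : 𝔸) - h μ x‖ ≤ τ₂ := h2 μ ν x hx
  have hHk : ‖(h μ (x.shift ν) : 𝔸) - h μ y₀‖ ≤ τ₂ * ((Site.tdist x y₀ : ℝ) + 1) := by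
    calc _ ≤ ‖(h μ (x.shift ν) : 𝔸) - h μ x‖ + ‖(h μ x : 𝔸) - h μ y₀‖ := norm_sub_le_norm_sub_add_norm_sub _ _ _
      _ ≤ τ₂ + τ₂ * (Site.tdist x y₀ : ℝ) := add_le_add hHH (norm_link_sub_tilt_le h y₀ h2 μ hx)
      _ = τ₂ * ((Site.tdist x y₀ : ℝ) + 1) := by ring
  -- assemble with the difference algebra
  have hA : 2 * ‖((((List.ofFn fun i => if ν < i then h i y₀ ^ (w + Pi.single μ 1 : Fin P.d → ℤ) i else 1).prod)⁻¹ * h ν y₀ *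
          (List.ofFn fun i => if ν < i then h i y₀ ^ (w + Pi.single μ 1 : Fin P.d → ℤ) i else 1).prod : 𝔸ˣ) : 𝔸) - 1‖ * ‖(h μ y₀ : 𝔸) - 1‖
      ≤ 2 * τ₁ * τ₁ :=
    mul_le_mul (mul_le_mul_of_nonneg_left hkh1 (by norm_num)) (hk1 μ) (norm_nonneg _) (mul_nonneg (by norm_num) hτ₁)
  have hB : (‖((((List.ofFn fun i => if ν < i then h i y₀ ^ w i else 1).prod)⁻¹ * h ν y₀ *
          (List.ofFn fun i => if ν < i then h i y₀ ^ w i else 1).prod : 𝔸ˣ) : 𝔸) - 1‖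
        + ‖((((List.ofFn fun i => if ν < i then h i y₀ ^ (w + Pi.single μ 1 : Fin P.d → ℤ) i else 1).prod)⁻¹ * h ν y₀ *
          (List.ofFn fun i => if ν < i then h i y₀ ^ (w + Pi.single μ 1 : Fin P.d → ℤ) i else 1).prod : 𝔸ˣ) : 𝔸) - 1‖)
        * ‖(h μ (x.shift ν) : 𝔸) - h μ y₀‖ ≤ (τ₁ + τ₁) * (τ₂ * ((Site.tdist x y₀ : ℝ) + 1)) :=
    mul_le_mul (add_le_add hkt1 hkh1) hHk (norm_nonneg _) (add_nonneg hτ₁ hτ₁)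
  refine (norm_regauged_sub_regauged_le
    (P := (List.ofFn fun i => h i y₀ ^ w i).prod)
    (P' := (List.ofFn fun i => h i y₀ ^ (w + Pi.single μ 1 : Fin P.d → ℤ) i).prod)
    (H := h μ x) (H' := h μ (x.shift ν)) (k := h μ y₀)
    (kt := ((List.ofFn fun i => if ν < i then h i y₀ ^ w i else 1).prod)⁻¹ * h ν y₀ *
      (List.ofFn fun i => if ν < i then h i y₀ ^ w i else 1).prod)
    (kh := ((List.ofFn fun i => if ν < i then h i y₀ ^ (w + Pi.single μ 1 : Fin P.d → ℤ) i else 1).prod)⁻¹ * h ν y₀ *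
      (List.ofFn fun i => if ν < i then h i y₀ ^ (w + Pi.single μ 1 : Fin P.d → ℤ) i else 1).prod)
    (bicontr_prod_ofFn_zpow _ hk w) (bicontr_prod_ofFn_zpow _ hk _) (hk μ).1 hkh).trans ?_
  have e : τ₂ + 4 * τ₁ ^ 2 + 2 * τ₁ * τ₂ * ((Site.tdist x y₀ : ℝ) + 1)
      = τ₂ + 2 * τ₁ ^ 2 + 2 * τ₁ * τ₁ + (τ₁ + τ₁) * (τ₂ * ((Site.tdist x y₀ : ℝ) + 1)) := by ring
  rw [e]
  linarith [hHH, hswap, hA, hB]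

end Torus

end Summit.QuantumFields.YangMills.Theorems.Prop7ConeRegaugeRows

end
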